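import Literature.Algebra.Homology.DiscreteRepContinuousCohomologyLES
import Literature.NumberTheory.GaloisRepresentations.GaloisCohomologyProofs
import HarnessLib

/-!
# First Galois consequences of `Extⁿ_{C_{Γ_K}}(ℤ, M) ≅ Hⁿ(K, M)`: Hilbert 90 and `H²(K, K̄ˣ)` on the
# `Ext` side; the long exact sequence for discrete Galois modules

Topic `Algebra/Homology`; namespace `Literature.Algebra.Homology.DiscreteRep`.  Sequel of
`DiscreteRepStandardResolution` (`extTrivAddEquivGaloisCohomology`), `…Naturality`, and
`DiscreteRepContinuousCohomologyLES`; no named fact, no `sorry`.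

For a field `K : Type` with compact absolute Galois group (e.g. characteristic `0`, the tree's
`instCompactSpace`), in the abelian category `C_{Γ_K} = DiscreteRepCat ℤ Γ_K` of discrete
`Γ_K`-modules (Harari's `C_G`, the category of the class-formation formalism of §16):

* **`ext_one_triv_units_eq_zero` — `Ext¹_{C_{Γ_K}}(ℤ, K̄ˣ) = 0`** (the class-formation axiom
  "`H¹(U, C) = 0`" at the base layer), transported from the tree's PROVED Hilbert 90
  `subsingleton_galoisCohomology_units_one_holds` (Serre, *Local Fields* X §1 Prop. 2).
* **`extTwoUnitsAddEquiv : Ext²_{C_{Γ_K}}(ℤ, K̄ˣ) ≃+ H²(K, K̄ˣ)`** = the Brauer group in the tree's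
  cochain presentation (on which the tree's local invariant maps are defined).
* the **long exact sequence of `galoisCohomology`** for a short exact sequence of discrete Galois
  modules given by continuous equivariant maps (`galoisConnectingHom`, `galoisCohomology_exact₂/₃/₁`),
  specialising `DiscreteRepContinuousCohomologyLES` — beyond the degrees `≤ 2` handled by hand in the
  tree so far.

## References
* D. Harari, *Galois Cohomology and Class Field Theory* (2020), Thm. 1.17, §4.3, Def. 16.1. [Harari2020]
* J.-P. Serre, *Local Fields* (1979), X §1 Prop. 2, X §3. [Serre1979]
-/

noncomputable section

namespace Literature.Algebra.Homology

namespace DiscreteRep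

open CategoryTheory CategoryTheory.Abelian Literature.NumberTheory.GaloisRepresentations Field
open scoped ContRepresentation

variable {K : Type} [Field K] [CompactSpace (absoluteGaloisGroup K)]

/-! ## §1 Hilbert 90 and the Brauer group on the `Ext` side -/

/-- **`Ext¹_{C_{Γ_K}}(ℤ, K̄ˣ) = 0`** (Hilbert 90, transported through the comparison).
[cite: Serre1979, Ch. X §1, Prop. 2][cite: Harari2020, Definition 16.1] -/
theorem ext_one_triv_units_eq_zero
    (e : Ext (triv (Γ := absoluteGaloisGroup K) ℤ) (ofDiscreteGaloisModule (DiscreteGaloisModule.units K)) 1) :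
    e = 0 := by
  haveI : Subsingleton (galoisCohomology (DiscreteGaloisModule.units K) 1) :=
    subsingleton_galoisCohomology_units_one_holds K
  apply (extTrivAddEquivGaloisCohomology (DiscreteGaloisModule.units K) 1).injective
  exact Subsingleton.elim _ _

/-- Equivalently: `Ext¹_{C_{Γ_K}}(ℤ, K̄ˣ)` is a subsingleton. [cite: Serre1979, Ch. X §1, Prop. 2] -/
instance subsingleton_ext_one_triv_units :
    Subsingleton (Ext (triv (Γ := absoluteGaloisGroup K) ℤ)
      (ofDiscreteGaloisModule (DiscreteGaloisModule.units K)) 1) :=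
  subsingleton_of_forall_eq 0 ext_one_triv_units_eq_zero

/-- **`Ext²_{C_{Γ_K}}(ℤ, K̄ˣ) ≃+ H²(K, K̄ˣ)`** (the degree-`2` instance of the comparison for the module
of units: the group on which the invariant maps of class field theory live).
[cite: Harari2020, §4.3, Remark 4.24] -/
def extTwoUnitsAddEquiv :
    Ext (triv (Γ := absoluteGaloisGroup K) ℤ) (ofDiscreteGaloisModule (DiscreteGaloisModule.units K)) 2 ≃+
      galoisCohomology (DiscreteGaloisModule.units K) 2 :=
  extTrivAddEquivGaloisCohomology (DiscreteGaloisModule.units K) 2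

/-! ## §2 The long exact sequence of Galois cohomology -/

section LES

variable {M₁ M₂ M₃ : Type} [AddCommGroup M₁] [TopologicalSpace M₁] [DiscreteTopology M₁]
  [AddCommGroup M₂] [TopologicalSpace M₂] [DiscreteTopology M₂]
  [AddCommGroup M₃] [TopologicalSpace M₃] [DiscreteTopology M₃]
  (ρ₁ : DiscreteGaloisModule K M₁) (ρ₂ : DiscreteGaloisModule K M₂) (ρ₃ : DiscreteGaloisModule K M₃)
  (f : ρ₁.toContRepresentation →ⁱL ρ₂.toContRepresentation)
  (g : ρ₂.toContRepresentation →ⁱL ρ₃.toContRepresentation)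
  (hfg : ∀ x, g (f x) = 0) (hf : Function.Injective f) (hg : Function.Surjective g)
  (hex : ∀ y, g y = 0 → ∃ x, f x = y)

/-- A continuous equivariant map as a morphism of Mathlib's `TopRep`. [cite: Harari2020, §4.2] -/
abbrev toTopRepHom {M N : Type} [AddCommGroup M] [TopologicalSpace M] [DiscreteTopology M]
    [AddCommGroup N] [TopologicalSpace N] [DiscreteTopology N] (ρ : DiscreteGaloisModule K M)
    (ρ' : DiscreteGaloisModule K N) (φ : ρ.toContRepresentation →ⁱL ρ'.toContRepresentation) :
    ρ.toTopRep ⟶ ρ'.toTopRep :=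
  TopRep.ofHom φ

/-- **The connecting homomorphism `δ : Hⁿ(K, M₃) →+ Hⁿ⁺¹(K, M₁)`** of a short exact sequence
`0 → M₁ → M₂ → M₃ → 0` of discrete Galois modules (continuous equivariant maps, exact on elements).
[cite: Harari2020, Theorem 1.17] -/
def galoisConnectingHom (n : ℕ) : galoisCohomology ρ₃ n →+ galoisCohomology ρ₁ (n + 1) :=
  connectingHom (k := ℤ) (X₁ := ρ₁.toTopRep) (X₂ := ρ₂.toTopRep) (X₃ := ρ₃.toTopRep)
    (isDiscrete_of_continuousRep ρ₁) (isDiscrete_of_continuousRep ρ₂) (isDiscrete_of_continuousRep ρ₃)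
    (toTopRepHom ρ₁ ρ₂ f) (toTopRepHom ρ₂ ρ₃ g) hfg hf hg hex n

include hfg hf hg hex in
/-- **Exactness at `Hⁿ(K, M₂)`.** [cite: Harari2020, Theorem 1.17] -/
theorem galoisCohomology_exact₂ (n : ℕ) :
    Function.Exact (galoisCohomology.map f n) (galoisCohomology.map g n) :=
  continuousCohomology_exact₂ (k := ℤ) (X₁ := ρ₁.toTopRep) (X₂ := ρ₂.toTopRep) (X₃ := ρ₃.toTopRep)
    (isDiscrete_of_continuousRep ρ₁) (isDiscrete_of_continuousRep ρ₂) (isDiscrete_of_continuousRep ρ₃)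
    (toTopRepHom ρ₁ ρ₂ f) (toTopRepHom ρ₂ ρ₃ g) hfg hf hg hex n

/-- **Exactness at `Hⁿ(K, M₃)`.** [cite: Harari2020, Theorem 1.17] -/
theorem galoisCohomology_exact₃ (n : ℕ) :
    Function.Exact (galoisCohomology.map g n) (galoisConnectingHom ρ₁ ρ₂ ρ₃ f g hfg hf hg hex n) :=
  continuousCohomology_exact₃ (k := ℤ) (X₁ := ρ₁.toTopRep) (X₂ := ρ₂.toTopRep) (X₃ := ρ₃.toTopRep)
    (isDiscrete_of_continuousRep ρ₁) (isDiscrete_of_continuousRep ρ₂) (isDiscrete_of_continuousRep ρ₃)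
    (toTopRepHom ρ₁ ρ₂ f) (toTopRepHom ρ₂ ρ₃ g) hfg hf hg hex n

/-- **Exactness at `Hⁿ⁺¹(K, M₁)`.** [cite: Harari2020, Theorem 1.17] -/
theorem galoisCohomology_exact₁ (n : ℕ) :
    Function.Exact (galoisConnectingHom ρ₁ ρ₂ ρ₃ f g hfg hf hg hex n) (galoisCohomology.map f (n + 1)) :=
  continuousCohomology_exact₁ (k := ℤ) (X₁ := ρ₁.toTopRep) (X₂ := ρ₂.toTopRep) (X₃ := ρ₃.toTopRep)
    (isDiscrete_of_continuousRep ρ₁) (isDiscrete_of_continuousRep ρ₂) (isDiscrete_of_continuousRep ρ₃)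
    (toTopRepHom ρ₁ ρ₂ f) (toTopRepHom ρ₂ ρ₃ g) hfg hf hg hex n

include ρ₃ g hfg hf hg hex in
/-- **`H⁰(K, M₁) → H⁰(K, M₂)` is injective.** [cite: Harari2020, Theorem 1.17] -/
theorem galoisCohomology_map_zero_injective : Function.Injective (galoisCohomology.map f 0) :=
  cohomologyMapHom_zero_injective (k := ℤ) (X₁ := ρ₁.toTopRep) (X₂ := ρ₂.toTopRep)
    (X₃ := ρ₃.toTopRep) (isDiscrete_of_continuousRep ρ₁) (isDiscrete_of_continuousRep ρ₂)
    (isDiscrete_of_continuousRep ρ₃) (toTopRepHom ρ₁ ρ₂ f) (toTopRepHom ρ₂ ρ₃ g) hfg hf hg hex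

end LES

end DiscreteRep

end Literature.Algebra.Homology
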